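import Literature.AlgebraicGeometry.Frobenioids.EquivalencePreStepsQuasiIsotropicFSMFF2024
import Literature.AlgebraicGeometry.Frobenioids.BaseCategoryTheoreticity
import HarnessLib

/-!
# Frobenioids I, Theorem 3.4 (ii): the typed per-instance statement, discharged over bases of
# FSMFF-type in the author's revised sense (and over bases of FSM-type)

Mochizuki, *The geometry of Frobenioids I: the general theory*, Kyushu J. Math. **62** (2008)
293–400, Thm. 3.4 (ii), kurims p. 62 [cite: MochizukiFrdI2008, Thm. 3.4 (ii) p.62], with condition
(b) of "FSMFF-type" as revised by the author (*Comments*, January 2024, item (28))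
[cite: MochizukiFrdIComments2024, (28) p.3].

PROOF-ONLY file (seat abc-iut-L1-t11). The cell types Thm. 3.4 (ii) per pair of pre-Frobenioid data
as `PreFrobenioidData.Thm34ii S₁ S₂ Ψ` (seat abc-iut-L1-t3, `BaseCategoryTheoreticity.lean`):
"quasi-isotropic ⇒ quasi-isotropic ⇒ `D₁` FSMFF ⇒ `D₂` FSMFF ⇒ `Ψ` preserves pre-steps, co-angular
pre-steps, group-like objects", the FSMFF hypotheses being the 2008 printed ones; consumers (e.g.
seat abc-iut-L1-d6's Cor. 5.7 (iv) `cor57iv_of`) take this per-instance statement as a hypothesis.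
Here it is DISCHARGED for every pair of Frobenioids whose base categories are of FSMFF-type in the
REVISED sense — in particular for all bases of FSM-type (connected objects of Galois categories,
`B^temp(Π)⁰`, the finite étale sites of [FrdII], cf. `FSMFFType2024Instances.lean`) — by
`FrdI.thm34ii_of_isOfFSMFFType2024` (`EquivalencePreStepsQuasiIsotropicFSMFF2024.lean`; the printed
2008 hypotheses inside `Thm34ii` are then not needed). The universally quantified named fact
`FrdI.Thm34ii` (all Frobenioids, 2008 hypotheses) is NOT discharged here (PR-1). No statement of the
paper is restated or strengthened.
-/

set_option backward.isDefEq.respectTransparency false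

namespace Literature.AlgebraicGeometry.Frobenioids

open CategoryTheory Opposite

universe w v v' u u'

namespace FrdI

section Two

variable {D₁ : Type u} [Category.{v} D₁] {Φ₁ : D₁ᵒᵖ ⥤ CommMonCat.{w}} {C₁ : Type u'}
  [Category.{v'} C₁] {D₂ : Type u} [Category.{v} D₂] {Φ₂ : D₂ᵒᵖ ⥤ CommMonCat.{w}} {C₂ : Type u'}
  [Category.{v'} C₂] {F₁ : C₁ ⥤ ElemFrobenioid Φ₁} {F₂ : C₂ ⥤ ElemFrobenioid Φ₂}

/-- **The typed per-instance [FrdI] Thm. 3.4 (ii), `PreFrobenioidData.Thm34ii`, HOLDS for every pair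
of Frobenioids over base categories of FSMFF-type in the author's revised (2024) sense** and every
equivalence `Ψ` (the 2008 FSMFF hypotheses of the typed statement are not used).
[cite: MochizukiFrdI2008, Thm. 3.4 (ii) p.62] [cite: MochizukiFrdIComments2024, (28) p.3] -/
theorem thm34ii_ofFunctor_of_isOfFSMFFType2024 (hF₁ : PreFrobenioid.IsFrobenioid F₁)
    (hF₂ : PreFrobenioid.IsFrobenioid F₂) (hD₁ : IsOfFSMFFType2024 D₁) (hD₂ : IsOfFSMFFType2024 D₂)
    (Ψ : C₁ ≌ C₂) :
    (PreFrobenioidData.ofFunctor Φ₁ F₁).Thm34ii (PreFrobenioidData.ofFunctor Φ₂ F₂) Ψ :=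
  fun hq₁ hq₂ _ _ => thm34ii_of_isOfFSMFFType2024 hF₁ hF₂ hq₁ hq₂ hD₁ hD₂ Ψ

/-- The same for `Ψ⁻¹` (the shape in which Cor. 5.7 (iv)'s discharge consumes it).
[cite: MochizukiFrdI2008, Thm. 3.4 (ii) p.62] -/
theorem thm34ii_ofFunctor_symm_of_isOfFSMFFType2024 (hF₁ : PreFrobenioid.IsFrobenioid F₁)
    (hF₂ : PreFrobenioid.IsFrobenioid F₂) (hD₁ : IsOfFSMFFType2024 D₁) (hD₂ : IsOfFSMFFType2024 D₂)
    (Ψ : C₁ ≌ C₂) :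
    (PreFrobenioidData.ofFunctor Φ₂ F₂).Thm34ii (PreFrobenioidData.ofFunctor Φ₁ F₁) Ψ.symm :=
  thm34ii_ofFunctor_of_isOfFSMFFType2024 hF₂ hF₁ hD₂ hD₁ Ψ.symm

/-- **… in particular over bases of FSM-type** ("FSM-type ⇒ FSMFF-type" survives the revision):
the typed per-instance Thm. 3.4 (ii) holds for every pair of Frobenioids over bases of FSM-type.
[cite: MochizukiFrdI2008, Thm. 3.4 (ii) p.62] -/
theorem thm34ii_ofFunctor_of_isOfFSMType (hF₁ : PreFrobenioid.IsFrobenioid F₁)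
    (hF₂ : PreFrobenioid.IsFrobenioid F₂) (hD₁ : IsOfFSMType D₁) (hD₂ : IsOfFSMType D₂) (Ψ : C₁ ≌ C₂) :
    (PreFrobenioidData.ofFunctor Φ₁ F₁).Thm34ii (PreFrobenioidData.ofFunctor Φ₂ F₂) Ψ :=
  thm34ii_ofFunctor_of_isOfFSMFFType2024 hF₁ hF₂ hD₁.isOfFSMFFType2024 hD₂.isOfFSMFFType2024 Ψ

end Two

end FrdI

end Literature.AlgebraicGeometry.Frobenioids
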